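import Summits.BirchSwinnertonDyer.BirchSwinnertonDyer.Theorems.SignedLowerHalvesKobayashiLowerHalfLargeImageLambdaTwoStratum
import Summits.BirchSwinnertonDyer.BirchSwinnertonDyer.Theorems.SignedLowerHalvesKobayashiLowerHalfLargeImageParityStratumMainConjecture
import Literature.NumberTheory.EllipticCurves.Kim2008.AlgebraicFunctionalEquationSigned
import Literature.NumberTheory.EllipticCurves.BDKim2013.SignedCharValueRankZero
import HarnessLib

/-!
# Route `SignedLowerHalves`, crux 3 `KobayashiLowerHalfLargeImage` (item stmt-BirchSwinnertonDyer-19001):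
# the `λ = 2` STRATUM, part 2 — Kobayashi's MAIN CONJECTURE `KobayashiMainConjecture W p ε` at every
# large-image pair with certificate `(μ, λ)(L_p^ε) = (0, 2)`, in the two branches
# «`corank_{ℤ_p} Sel_{p^∞}(E/ℚ) ≠ 0`» (any odd `p`) and «`Sel_{p^∞}(E/ℚ)` finite, `p ∣ ∏ c_ℓ · #Sel_{p^∞}(E/ℚ)`»
# (`p ≥ 5`) (cell `bsd-ssimc`, width seat `bsd-line-slh-p1-w2` gen 6; helper file `--supports 19001`;
# executes §4 (a) of `Cruxes/KobayashiLowerHalfLargeImage/K1G17-SEARCH-LOG.md`)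

HONEST FRAMING: the crux is OPEN and nothing here proves it for the class; BSD is not proved by any
of this. CONDITIONAL theorems on DISPLAYED binders — the PUBLISHED named facts Kobayashi 2003 Thm. 1.2
(`h12`) and Thm. 4.1 (`h41`, the Kato side `ξ^ε ∣ L_p^ε` under `p`-adic surjectivity), the
period-unit facts (`h5`, `h3`), Wuthrich 2014 Lemma 20 (`hL20`), the `p`-parity theorem (`hpar`),
Sprung's functional equation (`hFE`), B. D. Kim 2008 Thm. 3.12 (`hK08`: the ALGEBRAIC functional
equation `ι(Char X^ε) = Char X^ε` over `ℚ_∞`, printed for `p > 3`) and B. D. Kim 2013 Cor. 3.15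
(`hK13`: `ξ^ε(0) = u · p^{ord_p ∏ c_ℓ} · #Sel_{p^∞}(E/ℚ)`, `u ∈ ℤ_pˣ`, when `Sel_{p^∞}(E/ℚ)` is finite)
— and ONE per-pair certificate. CALIBRATION / SUPPORT ONLY (pen rule D34-4 (3)). Part 1 =
`…LambdaTwoStratum.lean` (algebra; `w(E) = +1`, even corank `≤ 2` on the stratum).

## What this file does

* §3 BRANCH «corank»: `kobayashiMainConjecture_of_lam_eq_two_of_two_le_selmerCorank` — certificate
  `(0, 2)` + `2 ≤ corank` ⇒ `KobayashiMainConjecture W p ε` at any odd good `p` with `a_p = 0` and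
  `ρ̄_{E,p}` onto: `T² ∣ ξ^ε` by the signed corank control (p635263), `ξ^ε ∣ L_p^ε` by Kato (`h41`),
  and the `λ`-squeeze (`λ(L_p^ε) = 2 ≤ λ(ξ^ε)`, `μ(L_p^ε) = 0`); NO parity, NO functional equation.
  `…_of_selmerCorank_ne_zero` — the same from `corank ≠ 0` (+ `hpar`, `hFE`: even corank, part 1 §2).
* §4 BRANCH «finite Selmer» (`5 ≤ p`): `kobayashiMainConjecture_of_lam_eq_two_of_finite_of_dvd` —
  certificate `(0, 2)` + `Sel_{p^∞}(E/ℚ)` finite + `p ∣ ∏ c_ℓ · #Sel_{p^∞}(E/ℚ)` ⇒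
  `KobayashiMainConjecture W p ε`: `ξ ∣ L_p^ε` gives `μ(ξ) = 0`, `λ(ξ) ≤ 2`; `λ(ξ) = 0` would make
  `ξ` a unit, but `p ∣ ξ(0)` (`hK13` + the divisibility bit); `λ(ξ) = 1` would give `ξ(0) = 0` by
  part 1's `constantCoeff_eq_zero_of_subst_eq_mul` applied to `ι ξ = v ξ` (`hK08`), but `ξ(0) ≠ 0`
  (`hK13`); so `λ(ξ) = 2` and `(ξ) = (L_p^ε)`. Corollary `…_of_dvd_tamagawa` — K1G17 §4 (a): the
  `p ∣ Tam(E)` rows are certified from Cremona/LMFDB Tamagawa data plus one Mazur–Tate certificate,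
  with NO Kurihara number, NO `#Ш`, NO `L`-value.

Populations (for the LEAD's line report): §4 serves the analytic-rank-`0` rows of the X7 window with
`λ(L_p^ε) = 2` for some `ε` and `p ∣ ∏ c_ℓ` (inside the cone of `closes`); §3 serves the rank-`≥ 2`
rows with a sharp certificate (inside the crux, outside the cone); neither needs the analytic rank.
At `p = 3` only §3 is available (Kim 2008 is printed for `p > 3`).

References: [Kobayashi2003] Thm. 1.2, Thm. 4.1, Conjecture (p. 2); [KimBD2008MRL] Thm. 3.12;
[BDKim2013] Cor. 3.15; [Sprung2017] Cor. 4.14; [DokchitserDokchitserAnnals2010] Thm. 1.4;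
[GreenbergLNM1716] §1 p. 65, §3 Lemma 3.1; [GreenbergVatsal2000] p. 4; [Wuthrich2014] Lemma 20.
Crux dir: `K1G17-SEARCH-LOG.md` §4 (the suggestion), `LineReportKuriharaRigidity.md` v8–v9.
-/

set_option autoImplicit false
set_option linter.dupNamespace false

noncomputable section

open scoped Classical MatrixGroups ModularForm

open CongruenceSubgroup PowerSeries WeierstrassCurve Literature.NumberTheory.EllipticCurves
  Literature.NumberTheory.EllipticCurves.ModularForms Literature.Barriers.BirchSwinnertonDyer
  Literature.NumberTheory.EllipticCurves.Rank1Residual Literature.NumberTheory.EllipticCurves.Sprung2017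
  Literature.NumberTheory.EllipticCurves.Kobayashi2003 ZpExtension
  Literature.NumberTheory.EllipticCurves.Rank1Residual.Typed
  Summit.BirchSwinnertonDyer.Rank1Residual Summit.BirchSwinnertonDyer.Rank1Residual.X1.MuLambda
  Summit.BirchSwinnertonDyer.Rank1Residual.Supersingular
  Summit.BirchSwinnertonDyer.BirchSwinnertonDyer.Theorems.LargeImageParityStratum

namespace Summit.BirchSwinnertonDyer.BirchSwinnertonDyer.Theorems.LargeImageLambdaTwoStratum

/-! ## §3. Branch «corank»: `2 ≤ corank Sel_{p^∞}(E/ℚ)` (equivalently, by §2, `≠ 0`) -/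

section Corank

variable (W : WeierstrassCurve ℚ) [W.IsElliptic] [W.IsGloballyMinimal] (p : ℕ) [Fact p.Prime]

/-- The tail common to every squeeze on the real objects: once `(ξ^ε) = (L_p^ε)` as ideals of `Λ`,
the period ratio `ϖ` (`ϖ Ω_E = Ω⁺_f`, a `p`-adic unit by `h5`/`h3` at an irreducible odd good `p`)
rescales the generator — `char X^ε = (g)` with `ι g = ϖ · ι L_p^ε`. Bookkeeping only.
[cite: Kobayashi2003, Conjecture (Main Conjecture) (p. 2)] [cite: GreenbergVatsal2000, p. 4 and §3 Remark 3.4] -/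
theorem exists_generator_of_span_eq
    (h5 : realPeriodRat_eq_unit_mul_plusPeriod) (h3 : realPeriodRat_eq_unit_mul_plusPeriod_three)
    (hp : p ≠ 2) (hgood : W.HasGoodReductionAtPrime p) (hap : W.frobeniusTrace p = 0)
    [NeZero (W.conductorNorm ℤ)] {f : CuspForm (Gamma0 (W.conductorNorm ℤ)) 2} (hf : IsNewformOf W f)
    {ϖ : ℚ} (hϖ : (ϖ : ℝ) * W.realPeriodRat = plusPeriod f) {ξ L : IwasawaAlgebra p}
    {I : Ideal (IwasawaAlgebra p)} (hI : I = Ideal.span {ξ})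
    (hspan : Ideal.span ({ξ} : Set (IwasawaAlgebra p)) = Ideal.span {L}) :
    ∃ g : IwasawaAlgebra p, I = Ideal.span {g} ∧
      iwasawaToPowerSeries p g = C (ϖ : ℚ_[p]) * iwasawaToPowerSeries p L := by
  have hirr : W.HasIrreducibleModPGaloisRep p :=
    hasIrreducibleModPGaloisRep_of_dvd_frobeniusTrace W p hp
      (W.not_dvd_minimalDiscriminantInt_of_hasGoodReductionAtPrime' p hgood) (by rw [hap]; exact dvd_zero _)
  have hvϖ : padicValRat p ϖ = 0 := padicValRat_periodRatio_eq_zero h5 h3 W p hp hgood hirr f hf ϖ hϖ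
  have hϖ0 : ϖ ≠ 0 := by
    intro h0
    rw [h0, Rat.cast_zero, zero_mul] at hϖ
    exact (IsNewform0.plusPeriod_pos_holds hf.1 hf.coeffField_eq_bot).ne' hϖ.symm
  obtain ⟨u, hu⟩ := exists_units_coe_eq_ratCast hϖ0 hvϖ
  obtain ⟨hspan', hι⟩ := span_C_units_mul_eq u L
  refine ⟨C (u : ℤ_[p]) * L, ?_, ?_⟩
  · rw [hI, hspan, hspan']
  · rw [hι, hu]

/-- **Kobayashi's main conjecture for `(E, p, ε)` at a pair with certificate `(μ, λ)(L_p^ε) = (0, 2)`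
and `corank_{ℤ_p} Sel_{p^∞}(E/ℚ) ≥ 2`** — any odd good `p` with `a_p = 0` and `ρ̄_{E,p}` onto
(`hs`; `p`-adic surjectivity by Serre / Wuthrich's Lemma 20 `hL20` at `p = 3`), `f₀` the newform of
level `N_E`, granted BY NAME Kobayashi Thm. 1.2 (`h12`) and Thm. 4.1 (`h41`: `ξ^ε ∣ L_p^ε`, the Kato
side) and the period-unit facts (`h5`, `h3`). Squeeze: `T^{corank} ∣ ξ^ε` by the signed corank
control (`SignedSelmerDualData.X_pow_selmerCorank_dvd_of_charIdeal_eq_span`, Greenberg's Lemma 3.1 on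
Kobayashi's objects), so `λ(ξ^ε) ≥ 2 = λ(L_p^ε)`; with `ξ^ε ∣ L_p^ε` and `μ(L_p^ε) = 0` the cofactor
is a unit. The rows it serves: `rank E(ℚ) ≥ 2` (outside the cone of `closes`, inside the crux) and
`corank Ш[p^∞] ≥ 2`; NO parity, NO functional equation used. PER PAIR in `hcert₀`/`hcork`.
[cite: Kobayashi2003, Thm. 1.2 (p. 2), Thm. 4.1 (p. 8) and Conjecture (p. 2)]
[cite: GreenbergLNM1716, §1 p. 65 and §3 Lemma 3.1] [cite: GreenbergVatsal2000, p. 4]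
[cite: Wuthrich2014, Lemma 20 (p. 399)] -/
theorem kobayashiMainConjecture_of_lam_eq_two_of_two_le_selmerCorank
    (h12 : Kobayashi2003.thm12_signedSelmerDual_finite_torsion)
    (h41 : Kobayashi2003.thm41_signedCharIdeal_divisibility)
    (h5 : realPeriodRat_eq_unit_mul_plusPeriod) (h3 : realPeriodRat_eq_unit_mul_plusPeriod_three)
    (hL20 : Wuthrich2014.lemma20_surjective_threeAdic_of_semistable)
    (hp : p ≠ 2) (hgood : W.HasGoodReductionAtPrime p) (hap : W.frobeniusTrace p = 0)
    (hs : Surj W p) (ε : ℤˣ)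
    [NeZero (W.conductorNorm ℤ)] {f₀ : CuspForm (Gamma0 (W.conductorNorm ℤ)) 2} (hf₀ : IsNewformOf W f₀)
    (hcert₀ : ∀ L : IwasawaAlgebra p, IsSignedPAdicLFunction f₀ p ε L → mu L = 0 ∧ lam L = 2)
    (hcork : 2 ≤ W.selmerCorank p) :
    KobayashiMainConjecture W p ε := by
  intro κ γ hκ hγ hγ' _ f hf ϖ hϖ Lplus Lminus hPP D
  have hff : f = f₀ := hf.unique hf₀
  subst hff
  haveI : Module.Finite (IwasawaAlgebra p) D.X := h12.moduleFinite hp hgood hap hκ hγ D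
  have hX : Module.IsTorsion (IwasawaAlgebra p) D.X := h12.isTorsion hp hgood hap hκ hγ D
  refine ⟨hX, ?_⟩
  obtain ⟨ξ, hξ⟩ := (charIdeal_isPrincipal_holds p D.X).principal
  have hξ' : D.charIdeal = Ideal.span {ξ} := hξ
  set L := kobayashiL ε Lplus Lminus with hL_def
  have hL : IsSignedPAdicLFunction f p ε L := hPP.isSignedPAdicLFunction_kobayashiL ε
  have hL0 : L ≠ 0 := kobayashiL_ne_zero p hPP ε
  -- (MC↑), integral: `ξ ∣ L` under `p`-adic surjectivity
  have hsurj : ∀ m : ℕ, W.HasSurjectiveModNGaloisRep (p ^ m : ℕ) :=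
    surjective_pow_of_surj_of_good W p hL20 hp hgood hs
  have hU : ξ ∣ L := h41.dvd_of_charIdeal_eq_span hp hgood hap hf hκ hγ hγ' hL D hX hsurj hξ'
  have hξ0 : ξ ≠ 0 := by
    obtain ⟨h, hh⟩ := hU
    exact fun h0 ↦ hL0 (by rw [hh, h0, zero_mul])
  -- the certificate, and `T² ∣ ξ` by the corank control
  obtain ⟨hμ, hlam⟩ := hcert₀ L hL
  have hC : (X : IwasawaAlgebra p) ^ 2 ∣ ξ :=
    (pow_dvd_pow X hcork).trans (D.X_pow_selmerCorank_dvd_of_charIdeal_eq_span hγ hX hξ')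
  have hlamξ : 2 ≤ lam ξ := X2.le_lam_of_X_pow_dvd hξ0 hC
  have hspan : Ideal.span ({ξ} : Set (IwasawaAlgebra p)) = Ideal.span {L} :=
    span_eq_span_of_dvd_of_lam_le hL0 hU hμ (by rw [hlam]; exact hlamξ)
  exact exists_generator_of_span_eq W p h5 h3 hp hgood hap hf hϖ hξ' hspan

/-- **The same with `corank_{ℤ_p} Sel_{p^∞}(E/ℚ) ≠ 0` in place of `≥ 2`**, granted in addition
`p_parity W p` (`hpar`) and Sprung's functional equation (`hFE`): on the `λ = 2` stratum the corank is
even (§2 `even_selmerCorank_of_lam_eq_two`), so `≠ 0` means `≥ 2`. So at such a pair the main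
conjecture holds as soon as `E(ℚ)` is infinite or `Ш(E/ℚ)[p^∞]` is infinite.
[cite: Kobayashi2003, Thm. 1.2, Thm. 4.1 and Conjecture (p. 2)] [cite: DokchitserDokchitserAnnals2010, Thm. 1.4]
[cite: Sprung2017, Cor. 4.14 (a_p = 0 display)] [cite: Wuthrich2014, Lemma 20 (p. 399)] -/
theorem kobayashiMainConjecture_of_lam_eq_two_of_selmerCorank_ne_zero
    (h12 : Kobayashi2003.thm12_signedSelmerDual_finite_torsion)
    (h41 : Kobayashi2003.thm41_signedCharIdeal_divisibility)
    (h5 : realPeriodRat_eq_unit_mul_plusPeriod) (h3 : realPeriodRat_eq_unit_mul_plusPeriod_three)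
    (hL20 : Wuthrich2014.lemma20_surjective_threeAdic_of_semistable)
    (hpar : p_parity W p) (hFE : Sprung2017.cor414_sharpFlat_functionalEquation_apZero)
    (hp : p ≠ 2) (hgood : W.HasGoodReductionAtPrime p) (hap : W.frobeniusTrace p = 0)
    (hs : Surj W p) (ε : ℤˣ)
    [NeZero (W.conductorNorm ℤ)] {f₀ : CuspForm (Gamma0 (W.conductorNorm ℤ)) 2} (hf₀ : IsNewformOf W f₀)
    (hcert₀ : ∀ L : IwasawaAlgebra p, IsSignedPAdicLFunction f₀ p ε L → mu L = 0 ∧ lam L = 2)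
    (hcork : W.selmerCorank p ≠ 0) :
    KobayashiMainConjecture W p ε := by
  -- the certificate read on ONE Pollack pair gives the parity of the corank
  obtain ⟨Lplus, Lminus, hPP⟩ :=
    exists_isPollackPair pollack_exists_plusMinusPAdicLFunction_holds hp hf₀ hgood hap
  obtain ⟨hμ, hlam⟩ := hcert₀ _ (hPP.isSignedPAdicLFunction_kobayashiL ε)
  have hev := even_selmerCorank_of_lam_eq_two W p hpar hFE hp hgood hap hf₀ hPP ε hμ hlam
  have h2 : 2 ≤ W.selmerCorank p := by
    obtain ⟨k, hk⟩ := hev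
    omega
  exact kobayashiMainConjecture_of_lam_eq_two_of_two_le_selmerCorank W p h12 h41 h5 h3 hL20 hp hgood
    hap hs ε hf₀ hcert₀ h2

end Corank

/-! ## §4. Branch «finite Selmer»: `Sel_{p^∞}(E/ℚ)` finite and `p ∣ ∏ c_ℓ · #Sel_{p^∞}(E/ℚ)` (`p ≥ 5`) -/

section FiniteSelmer

variable (W : WeierstrassCurve ℚ) [W.IsElliptic] [W.IsGloballyMinimal] (p : ℕ) [Fact p.Prime]

/-- **Kobayashi's main conjecture for `(E, p, ε)` at a pair with certificate `(μ, λ)(L_p^ε) = (0, 2)`,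
`Sel_{p^∞}(E/ℚ)` FINITE and `p ∣ ∏_ℓ c_ℓ · #Sel_{p^∞}(E/ℚ)`** — `p ≥ 5` good with `a_p = 0`,
`ρ̄_{E,p}` onto, `f₀` the newform of level `N_E`; granted BY NAME Kobayashi Thm. 1.2 (`h12`), Thm. 4.1
(`h41`, Kato side), the period-unit facts (`h5`, `h3`), Wuthrich's Lemma 20 (`hL20`, idle at `p ≥ 5`
but kept for the shared `surjective_pow_of_surj_of_good`), B. D. Kim 2008 Thm. 3.12 (`hK08`: the
algebraic functional equation `ι(Char X^ε) = Char X^ε`, printed for `p > 3` — the reason for `5 ≤ p`)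
and B. D. Kim 2013 Cor. 3.15 (`hK13`: `ξ^ε(0) = u · p^{ord_p ∏ c_ℓ} · #Sel_{p^∞}(E/ℚ)`, `u ∈ ℤ_pˣ`).
Proof: `ξ ∣ L_p^ε` (Kato) gives `μ(ξ) = 0` and `λ(ξ) ≤ 2`; `λ(ξ) = 0` would make `ξ` a unit of `Λ`,
but `p ∣ ξ(0)` by `hK13` and the divisibility hypothesis; `λ(ξ) = 1` would give `ξ(0) = 0` by §1
(`constantCoeff_eq_zero_of_subst_eq_mul`) applied to `ι ξ = v ξ` (`hK08`), but `ξ(0) ≠ 0` by `hK13`;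
hence `λ(ξ) = 2 = λ(L_p^ε)` and `(ξ) = (L_p^ε)`. NO parity, NO analytic functional equation, NO
`#Ш` or `L`-value: the per-pair inputs are the certificate and ONE bit `p ∣ Tam(E)·#Sel_{p^∞}(E/ℚ)`.
PER PAIR in `hcert₀`/`hfin`/`hdvd`; CONDITIONAL on the displayed binders.
[cite: Kobayashi2003, Thm. 1.2 (p. 2), Thm. 4.1 (p. 8) and Conjecture (p. 2)] [cite: KimBD2008MRL, Thm. 3.12 (p. 93)]
[cite: BDKim2013, Cor. 3.15 (p. 199)] [cite: GreenbergVatsal2000, p. 4] [cite: Wuthrich2014, Lemma 20 (p. 399)] -/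
theorem kobayashiMainConjecture_of_lam_eq_two_of_finite_of_dvd
    (h12 : Kobayashi2003.thm12_signedSelmerDual_finite_torsion)
    (h41 : Kobayashi2003.thm41_signedCharIdeal_divisibility)
    (h5 : realPeriodRat_eq_unit_mul_plusPeriod) (h3 : realPeriodRat_eq_unit_mul_plusPeriod_three)
    (hL20 : Wuthrich2014.lemma20_surjective_threeAdic_of_semistable)
    (hK08 : Kim2008.thm312_signedSelmerDual_charIdeal_map_invol)
    (hK13 : BDKim2013.cor315_signedCharValue_rankZero)
    (hp5 : 5 ≤ p) (hgood : W.HasGoodReductionAtPrime p) (hap : W.frobeniusTrace p = 0)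
    (hs : Surj W p) (ε : ℤˣ)
    [NeZero (W.conductorNorm ℤ)] {f₀ : CuspForm (Gamma0 (W.conductorNorm ℤ)) 2} (hf₀ : IsNewformOf W f₀)
    (hcert₀ : ∀ L : IwasawaAlgebra p, IsSignedPAdicLFunction f₀ p ε L → mu L = 0 ∧ lam L = 2)
    (hfin : Finite (W.selmerGroupPInfty p))
    (hdvd : p ∣ W.tamagawaProduct * Nat.card (W.selmerGroupPInfty p)) :
    KobayashiMainConjecture W p ε := by
  have hpP : p.Prime := Fact.out
  have hp : p ≠ 2 := by omega
  have hp3 : 3 < p := by omega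
  intro κ γ hκ hγ hγ' _ f hf ϖ hϖ Lplus Lminus hPP D
  have hff : f = f₀ := hf.unique hf₀
  subst hff
  haveI : Module.Finite (IwasawaAlgebra p) D.X := h12.moduleFinite hp hgood hap hκ hγ D
  have hX : Module.IsTorsion (IwasawaAlgebra p) D.X := h12.isTorsion hp hgood hap hκ hγ D
  refine ⟨hX, ?_⟩
  obtain ⟨ξ, hξ⟩ := (charIdeal_isPrincipal_holds p D.X).principal
  have hξ' : D.charIdeal = Ideal.span {ξ} := hξ
  set L := kobayashiL ε Lplus Lminus with hL_def
  have hL : IsSignedPAdicLFunction f p ε L := hPP.isSignedPAdicLFunction_kobayashiL ε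
  have hL0 : L ≠ 0 := kobayashiL_ne_zero p hPP ε
  -- (MC↑), integral: `ξ ∣ L`; hence `μ(ξ) = 0`
  have hsurj : ∀ m : ℕ, W.HasSurjectiveModNGaloisRep (p ^ m : ℕ) :=
    surjective_pow_of_surj_of_good W p hL20 hp hgood hs
  have hU : ξ ∣ L := h41.dvd_of_charIdeal_eq_span hp hgood hap hf hκ hγ hγ' hL D hX hsurj hξ'
  obtain ⟨hμ, hlam⟩ := hcert₀ L hL
  obtain ⟨h, hh⟩ := hU
  have hξ0 : ξ ≠ 0 := fun h0 ↦ hL0 (by rw [hh, h0, zero_mul])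
  have hh0 : h ≠ 0 := fun h0 ↦ hL0 (by rw [hh, h0, mul_zero])
  have hμξ : mu ξ = 0 := by
    have hle := mu_le_mu_mul hξ0 hh0
    rw [← hh, hμ] at hle
    exact Nat.le_zero.mp hle
  -- `ξ(0) ≠ 0` and `p ∣ ξ(0)` (Kim 2013 Cor. 3.15 + the divisibility bit)
  have hc0ne : constantCoeff ξ ≠ 0 :=
    BDKim2013.cor315_signedCharValue_rankZero.constantCoeff_ne_zero hK13 hp hgood hap hκ hγ D hX hξ' hfin
  have hc0dvd : (p : ℤ_[p]) ∣ constantCoeff ξ := by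
    obtain ⟨u, hu⟩ := hK13 W p hp hgood hap κ γ hκ hγ ε D hX ξ hξ' hfin
    have hu' : constantCoeff ξ = (u : ℤ_[p]) * (p : ℤ_[p]) ^ padicValNat p W.tamagawaProduct *
        (Nat.card (W.selmerGroupPInfty p) : ℤ_[p]) := by
      refine PadicInt.ext ?_
      push_cast
      exact hu
    rw [hu']
    rcases hpP.dvd_mul.mp hdvd with ht | hc
    · have ht1 : 1 ≤ padicValNat p W.tamagawaProduct :=
        one_le_padicValNat_of_dvd (W.tamagawaProduct_pos').ne' ht
      exact Dvd.dvd.mul_right (Dvd.dvd.mul_left (dvd_pow_self _ (by omega)) _) _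
    · exact Dvd.dvd.mul_left (Nat.cast_dvd_cast hc) _
  -- `λ(ξ) ≥ 2`: `λ(ξ) = 0` ⇒ unit, `λ(ξ) = 1` ⇒ `ξ(0) = 0` by the algebraic functional equation
  have hlamξ : 2 ≤ lam ξ := by
    by_contra hlt
    rcases Nat.le_one_iff_eq_zero_or_eq_one.mp (Nat.lt_succ_iff.mp (not_le.mp hlt)) with hl | hl
    · have hunit : IsUnit ξ := (isUnit_iff_mu_eq_zero_and_lam_eq_zero ξ).mpr ⟨hξ0, hμξ, hl⟩
      exact not_isUnit_of_dvd hc0dvd (PowerSeries.isUnit_iff_constantCoeff.mp hunit)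
    · obtain ⟨v, hv⟩ := Kim2008.thm312_signedSelmerDual_charIdeal_map_invol.exists_unit_invol_generator
        hK08 W p hp3 hgood hap κ γ hκ hγ ε D ξ hξ'
      rw [IwasawaAlgebra.invol_apply] at hv
      have hι : (1 + X : IwasawaAlgebra p) * (IwasawaAlgebra.invSubOne p + 1) = 1 := by
        rw [add_comm (IwasawaAlgebra.invSubOne p) 1]
        exact IwasawaAlgebra.one_add_X_mul_one_add_invSubOne p
      have h1 : ¬ (p : ℤ_[p]) ∣ coeff 1 ξ := by rw [← hl]; exact not_dvd_coeff_lam hξ0 hμξ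
      exact hc0ne (constantCoeff_eq_zero_of_subst_eq_mul hp hι hc0dvd h1 hv)
  have hspan : Ideal.span ({ξ} : Set (IwasawaAlgebra p)) = Ideal.span {L} :=
    span_eq_span_of_dvd_of_lam_le hL0 ⟨h, hh⟩ hμ (by rw [hlam]; exact hlamξ)
  exact exists_generator_of_span_eq W p h5 h3 hp hgood hap hf hϖ hξ' hspan

/-- **Corollary — the `p ∣ Tam(E)` rows (K1G17 §4 (a)): `(μ, λ)(L_p^ε) = (0, 2)`, `Sel_{p^∞}(E/ℚ)`
finite and `p ∣ ∏_ℓ c_ℓ` ⇒ Kobayashi's main conjecture for `(E, p, ε)`** (`p ≥ 5`, `a_p = 0`, `ρ̄`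
onto; binders as above). These rows are certified from Tamagawa data alone — no Kurihara number, no
`#Ш`, no `L`-value beyond the Mazur–Tate certificate. [cite: Kobayashi2003, Thm. 1.2, Thm. 4.1 and Conjecture (p. 2)]
[cite: KimBD2008MRL, Thm. 3.12 (p. 93)] [cite: BDKim2013, Cor. 3.15 (p. 199)] -/
theorem kobayashiMainConjecture_of_lam_eq_two_of_finite_of_dvd_tamagawa
    (h12 : Kobayashi2003.thm12_signedSelmerDual_finite_torsion)
    (h41 : Kobayashi2003.thm41_signedCharIdeal_divisibility)
    (h5 : realPeriodRat_eq_unit_mul_plusPeriod) (h3 : realPeriodRat_eq_unit_mul_plusPeriod_three)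
    (hL20 : Wuthrich2014.lemma20_surjective_threeAdic_of_semistable)
    (hK08 : Kim2008.thm312_signedSelmerDual_charIdeal_map_invol)
    (hK13 : BDKim2013.cor315_signedCharValue_rankZero)
    (hp5 : 5 ≤ p) (hgood : W.HasGoodReductionAtPrime p) (hap : W.frobeniusTrace p = 0)
    (hs : Surj W p) (ε : ℤˣ)
    [NeZero (W.conductorNorm ℤ)] {f₀ : CuspForm (Gamma0 (W.conductorNorm ℤ)) 2} (hf₀ : IsNewformOf W f₀)
    (hcert₀ : ∀ L : IwasawaAlgebra p, IsSignedPAdicLFunction f₀ p ε L → mu L = 0 ∧ lam L = 2)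
    (hfin : Finite (W.selmerGroupPInfty p)) (hdvd : p ∣ W.tamagawaProduct) :
    KobayashiMainConjecture W p ε :=
  kobayashiMainConjecture_of_lam_eq_two_of_finite_of_dvd W p h12 h41 h5 h3 hL20 hK08 hK13 hp5 hgood hap
    hs ε hf₀ hcert₀ hfin (Dvd.dvd.mul_right hdvd _)

end FiniteSelmer

end Summit.BirchSwinnertonDyer.BirchSwinnertonDyer.Theorems.LargeImageLambdaTwoStratum

end
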